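import Summits.QuantumAdvantage.AdviceFreeQNC0.CrossFreeWindowFibre
import Summits.QuantumAdvantage.AdviceFreeQNC0.WindowLocalHard
import Summits.QuantumAdvantage.AdviceFreeQNC0.TwoBlindSpotsFlip
import HarnessLib

/-!
# Cell qa-qnc0 — walk strategies that are WINDOW-LOCAL INSIDE A LONG FREE WINDOW (arbitrary outside) lose: `ringWinU_freeWalkWindow_le`

u-frame companion of `RingWindowLocalLt3Proof.lean` (g23; letter-local bells), simpler because no transport is needed: a walk
strategy `y` on `n` bits such that every selector `y_g` depends on the bits of a walk window `[a, a+L)` only through its own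
radius-`r` neighbourhood `u_{g−r}, …, u_{g+r−1}` — and ARBITRARILY on the bits outside `[a, a+L)` — wins the walk game, every
charge, on at most `θ·2ⁿ`, with the `θ < 1` of the cross-free window theorem, as soon as `L ≥ 2B + r`, `B ≥ n₀`, `2r ≤ c₁√B`.

Proof: on every outside fibre `(A, B')` each selector is a `2r`-junta of the window bits (`hasDeg_freeFibre`, junta lemma
`ind_mem_lowDeg_of_dependsOn`), and the blocks `[a, a+B) ++ [a+B, a+B+r) ++ [a+B+r, a+2B+r)` are cross-free; then
`CrossFreeWindowFibre.ringWinU_crossFree_sqrt_le_fibre`.  Consumer: `CommonGatesHardPolylog.lean` (main term of the rung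
"polylog-many common MOD₃ gates ⊗ walk windows").

WHAT THIS IS NOT: `θ` is the unoptimised cross-cell constant; crux 22907 untouched; no separation.

References: S. Srinivasan, *A robust version of Hegedűs's lemma, with applications*, TheoretiCS 2 (2023), Lemma 3.1
[Srinivasan2023] (through `ringWinU_crossFree_sqrt_le_fibre`).
-/

noncomputable section

namespace Summit.QuantumAdvantage.AdviceFreeQNC0

open Finset
open Literature.Computability.MetaComplexity Literature.Computability.MetaComplexity.Smolensky

namespace FreeWalkWindow

variable {a W q r L : ℕ} {y : Fin (a + W + q + 1) → (Fin (a + W + q) → Bool) → Bool}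

/-- The window coordinates a fibre-restricted selector can read, `{i < W : g − r ≤ a + i < g + r}`, are `≤ 2r`. -/
theorem card_read_le (a W r g : ℕ) :
    (univ.filter fun i : Fin W => g ≤ a + i.val + r ∧ a + i.val < g + r).card ≤ 2 * r := by
  calc (univ.filter fun i : Fin W => g ≤ a + i.val + r ∧ a + i.val < g + r).card
      ≤ (Finset.range (2 * r)).card := by
        refine Finset.card_le_card_of_injOn (fun i => a + i.val + r - g) ?_ ?_
        · intro i hi
          rw [Finset.mem_coe, mem_filter] at hi
          rw [Finset.mem_coe, Finset.mem_range]
          show a + i.val + r - g < 2 * r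
          omega
        · intro i hi i' hi' h
          rw [Finset.mem_coe, mem_filter] at hi hi'
          have h' : a + i.val + r - g = a + i'.val + r - g := h
          exact Fin.ext (by omega)
    _ = 2 * r := Finset.card_range _

/-- **Fibre dependence**: on the outside fibre `(A, B')` the restricted selector reads only its radius-`r` window coordinates. -/
theorem dependsOn_freeFibre (hW : W ≤ L)
    (hy : ∀ (g : Fin (a + W + q + 1)) (u u' : Fin (a + W + q) → Bool),
      (∀ i : Fin (a + W + q), (i.val < a ∨ a + L ≤ i.val) ∨ (g.val ≤ i.val + r ∧ i.val < g.val + r) → u i = u' i) →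
        y g u = y g u')
    (g : Fin (a + W + q + 1)) (A : Fin a → Bool) (B' : Fin q → Bool) (w w' : Fin W → Bool)
    (hww : ∀ i ∈ (univ.filter fun i : Fin W => g.val ≤ a + i.val + r ∧ a + i.val < g.val + r), w i = w' i) :
    y g (glue3 A w B') = y g (glue3 A w' B') := by
  refine hy g _ _ fun m hm => ?_
  by_cases hmid : a ≤ m.val ∧ m.val < a + W
  · rw [glue3_apply_mid A w B' m hmid.1 hmid.2, glue3_apply_mid A w' B' m hmid.1 hmid.2]
    have hnear : g.val ≤ m.val + r ∧ m.val < g.val + r := by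
      rcases hm with hout | hnear
      · exfalso; omega
      · exact hnear
    exact hww _ (by rw [mem_filter]; exact ⟨mem_univ _, by simp only; omega, by simp only; omega⟩)
  · rcases Nat.lt_or_ge m.val a with h1 | h1
    · rw [glue3_apply_lt A w B' m h1, glue3_apply_lt A w' B' m h1]
    · have h2 : a + W ≤ m.val := by omega
      rw [glue3_apply_ge A w B' m h2, glue3_apply_ge A w' B' m h2]

/-- **Fibre degree `≤ 2r`.** -/
theorem hasDeg_freeFibre (hW : W ≤ L)
    (hy : ∀ (g : Fin (a + W + q + 1)) (u u' : Fin (a + W + q) → Bool),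
      (∀ i : Fin (a + W + q), (i.val < a ∨ a + L ≤ i.val) ∨ (g.val ≤ i.val + r ∧ i.val < g.val + r) → u i = u' i) →
        y g u = y g u')
    (g : Fin (a + W + q + 1)) (A : Fin a → Bool) (B' : Fin q → Bool) :
    HasDeg (fun w : Fin W → Bool => y g (glue3 A w B')) (2 * r) := by
  classical
  unfold HasDeg
  have h := ind_mem_lowDeg_of_dependsOn (F := ZMod 2)
    (univ.filter fun i : Fin W => g.val ≤ a + i.val + r ∧ a + i.val < g.val + r)
    (fun w : Fin W → Bool => y g (glue3 A w B'))
    (fun w w' hww => dependsOn_freeFibre hW hy g A B' w w' hww)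
  exact lowDeg_mono (card_read_le a W r g.val) h

end FreeWalkWindow

section CrossFree

variable {a B q r L : ℕ} {y : Fin (a + (B + r + B) + q + 1) → (Fin (a + (B + r + B) + q) → Bool) → Bool}

/-- Selectors strictly inside the first block do not read the third block. -/
theorem FreeWalkWindow.crossFree_x (hW : B + r + B ≤ L)
    (hy : ∀ (g : Fin (a + (B + r + B) + q + 1)) (u u' : Fin (a + (B + r + B) + q) → Bool),
      (∀ i : Fin (a + (B + r + B) + q), (i.val < a ∨ a + L ≤ i.val) ∨ (g.val ≤ i.val + r ∧ i.val < g.val + r) →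
        u i = u' i) → y g u = y g u')
    (g : Fin (a + (B + r + B) + q + 1)) (h2 : g.val < a + B)
    (A : Fin a → Bool) (xb : Fin B → Bool) (h : Fin r → Bool) (z z' : Fin B → Bool) (B' : Fin q → Bool) :
    y g (glue3 A (glue3 xb h z) B') = y g (glue3 A (glue3 xb h z') B') := by
  refine hy g _ _ fun m hm => glue3_glue3_eq_off_z A xb h z z' B' m ?_
  rintro ⟨hm1, hm2⟩
  rcases hm with hout | hnear <;> omega

/-- Selectors strictly inside the third block do not read the first block. -/
theorem FreeWalkWindow.crossFree_z (hW : B + r + B ≤ L)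
    (hy : ∀ (g : Fin (a + (B + r + B) + q + 1)) (u u' : Fin (a + (B + r + B) + q) → Bool),
      (∀ i : Fin (a + (B + r + B) + q), (i.val < a ∨ a + L ≤ i.val) ∨ (g.val ≤ i.val + r ∧ i.val < g.val + r) →
        u i = u' i) → y g u = y g u')
    (g : Fin (a + (B + r + B) + q + 1)) (h1 : a + (B + r) < g.val) (h2 : g.val < a + (B + r + B))
    (A : Fin a → Bool) (xb xb' : Fin B → Bool) (h : Fin r → Bool) (z : Fin B → Bool) (B' : Fin q → Bool) :
    y g (glue3 A (glue3 xb h z) B') = y g (glue3 A (glue3 xb' h z) B') := by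
  refine hy g _ _ fun m hm => glue3_glue3_eq_off_x A xb xb' h z B' m ?_
  rintro ⟨hm1, hm2⟩
  rcases hm with hout | hnear <;> omega

end CrossFree

open FreeWalkWindow

/-- **Window-local inside a long free window ⇒ the walk game is lost on a constant fraction** (every charge).  With the
constants `θ, c₁, n₀` of the fibre-degree cross-free window theorem: for every radius `r` and block length `B ≥ n₀` with
`2r ≤ c₁√B`, every window `[a, a+L)`, `L ≥ 2B + r`, `a + L ≤ n`, and every walk strategy whose selectors read the window bits only
inside their own radius-`r` neighbourhood (and the outside bits arbitrarily), `#{u : WIN_c} ≤ θ·2ⁿ`. [cite: Srinivasan2023, Lemma 3.1] -/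
theorem ringWinU_freeWalkWindow_le :
    ∃ θ : ℝ, θ < 1 ∧ ∃ c₁ : ℝ, 0 < c₁ ∧ ∃ n₀ : ℕ, ∀ r B : ℕ, n₀ ≤ B → ((2 * r : ℕ) : ℝ) ≤ c₁ * Real.sqrt B →
      ∀ n c a L : ℕ, 2 * B + r ≤ L → a + L ≤ n →
      ∀ y : Fin (n + 1) → (Fin n → Bool) → Bool,
        (∀ (g : Fin (n + 1)) (u u' : Fin n → Bool),
            (∀ i : Fin n, (i.val < a ∨ a + L ≤ i.val) ∨ (g.val ≤ i.val + r ∧ i.val < g.val + r) → u i = u' i) →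
              y g u = y g u') →
          ((univ.filter fun u : Fin n → Bool => ringWinU c y u = true).card : ℝ) ≤ θ * (2 : ℝ) ^ n := by
  classical
  obtain ⟨θ, hθ, c₁, hc₁, n₀, H⟩ := ringWinU_crossFree_sqrt_le_fibre
  refine ⟨θ, hθ, c₁, hc₁, n₀, fun r B hB hD n c a L hL haL y hy => ?_⟩
  -- layout: `n = a + (B + r + B) + q`
  obtain ⟨q, rfl⟩ : ∃ q, n = a + (B + r + B) + q := ⟨n - (a + (B + r + B)), by omega⟩
  have hW : B + r + B ≤ L := by omega
  refine H a B r B q hB hB (2 * r) hD hD c y ?_ ?_ ?_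
  · intro g A B'
    exact hasDeg_freeFibre (a := a) (W := B + r + B) (q := q) hW hy g A B'
  · intro g _ h2 A xb h z z' B'
    exact crossFree_x hW hy g h2 A xb h z z' B'
  · intro g h1 h2 A xb xb' h z B'
    exact crossFree_z hW hy g h1 h2 A xb xb' h z B'

end Summit.QuantumAdvantage.AdviceFreeQNC0

end
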